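import Literature.NumberTheory.EllipticCurves.HasseWeilAbelian
import Literature.NumberTheory.GaloisRepresentations.ArtinConductor
import Literature.NumberTheory.DiophantineGeometry.LocalReduction
import Mathlib.AlgebraicGeometry.EllipticCurve.Reduction
import Mathlib.AlgebraicGeometry.EllipticCurve.Affine.Point
import Mathlib.FieldTheory.IsAlgClosed.AlgebraicClosure
import HarnessLib

/-!
# Inertia invariants of the Tate module and the reduced curve (Serre–Tate; Silverman *ATAEC* IV.10.2(a), proof)

Topic `EllipticCurves`, sibling of `HasseWeilAbelian` (trunk EllArithM, item C15) and of the
decomposition file `HasseWeilAbelianConductor`.  Bottom-up step below the two bad-place cases of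
Silverman *ATAEC* Thm. IV.10.2(a) vendored there
(`WeierstrassCurve.codimFixed_inertia_rationalTate_eq_one_of_hasMultiplicativeReductionAt`,
`…_eq_two_of_hasAdditiveReductionAt`): both are read off, in the printed proof (PDF p. 359 of the
held copy, "This proof is taken from Serre–Tate [1]"), from the **fundamental isomorphism**

  `V_ℓ(E(K̄))^{I(K̄/K)} ≅ V_ℓ(Ẽ_ns(k̄))`

between the inertia invariants of the rational Tate module of an elliptic curve `E` over a local
field `K` of residue characteristic `p ≠ ℓ` and the rational Tate module of the group
`Ẽ_ns(k̄)` of non-singular points, over the algebraic closure `k̄` of the residue field, of the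
reduction `Ẽ` of a minimal Weierstrass equation for `E/K` (Serre–Tate, *Good reduction of abelian
varieties*, Ann. of Math. 88 (1968), §1, Lemma 2, for abelian varieties and the identity
component of the special fibre of the Néron model; for elliptic curves `Ẽ_ns = 𝓔̃⁰`, *ATAEC*
IV.9.2(c)).  Its printed proof: `E(K^nr)/E₀(K^nr)` is finite (IV.9.2(d), Kodaira–Néron),
`E₁(K^nr)` has no `ℓ`-torsion (AEC VII.3.1), reduction `E₀(K^nr) ↠ Ẽ_ns(k̄)` (AEC VII.2.1), so
`V_ℓ(E(K^nr)) ≅ V_ℓ(E₀(K^nr)) ≅ V_ℓ(Ẽ_ns(k̄))`, and `V_ℓ(E(K^nr)) = V_ℓ(E(K̄))^{I(K̄/K)}`.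
Then (p. 359) `ε = 2 - dim V_ℓ(Ẽ_ns(k̄))` with `V_ℓ(Ẽ) ≅ ℚ_ℓ²`, `V_ℓ(k̄^*) ≅ ℚ_ℓ`,
`V_ℓ(k̄⁺) = 0` by AEC VII.5.1 / III.2.5 (the latter is proved in the tree: `SingularCubic`).

This file vendors the fundamental isomorphism as the named fact
`WeierstrassCurve.nonempty_fixedSubmodule_inertia_rationalTate_equiv_reductionPoints` for an
elliptic curve over a number field `K` at a finite place `v ∤ ℓ` and a prime `𝔓 ∣ v` of
`\bar ℤ_K` (the setting of `HasseWeilAbelian` / `HasseWeilAbelianConductor`), after naming the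
object on its right-hand side:

* `WeierstrassCurve.reductionAlgClosure v W` — the reduction `Ẽ_v` of the local minimal model of
  `W` at `v` (Mathlib `WeierstrassCurve.reduction` of `W.localMinimalModel v` over
  `O_v = v.adicCompletionIntegers K`, i.e. `W.localMinimalIntegralModel v` reduced modulo `𝔪_v`),
  base-changed to the algebraic closure `k̄_v` of the residue field `k_v` of `O_v`; its Mathlib
  point group `(W.reductionAlgClosure v).toAffine.Point` **is** Silverman's `Ẽ_ns(k̄_v)` (Mathlib's
  affine points are the non-singular solutions, and its group law is available for every
  Weierstrass cubic over a field — AEC III.2.5 in the tree's `SingularCubic`).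

The sibling proof file `HasseWeilAbelianInertiaInvariantsProofs` derives from the fact the two
bad-place cases of 10.2(a) (hence 10.2(a) itself, via `HasseWeilAbelianConductorProofs`).

## On faithfulness

* Local versus global.  Silverman's statement is over the local field `K_v`; here `K` is a number
  field, `I_𝔓 ≤ Γ_K` (Mathlib `Ideal.inertia`) is the inertia group of a prime `𝔓` of `\bar ℤ_K`
  above `v`, i.e. the image of `I(K̄_v/K_v)` under the decomposition-group isomorphism
  (Neukirch, *ANT*, II (9.6); `IsDedekindDomain.HeightOneSpectrum.exists_mem_inertia_apply_eq` in
  the tree), and `V_ℓ(E(K̄)) = V_ℓ(E(K̄_v))` because torsion points are algebraic; so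
  `(V_ℓ E)^{I_𝔓}` **is** `V_ℓ(E(K̄_v))^{I(K̄_v/K_v)}`, exactly as for the sibling facts of
  `HasseWeilAbelianConductor`.  The reduction is that of the minimal model over `O_v`
  (`W.localMinimalModel v`, the model on which `HasGoodReductionAt` etc. are read), as printed.
* Only the existence of a `ℚ_ℓ`-linear isomorphism is asserted (what the printed proof uses:
  `ε(E/K) = 2 - dim V_ℓ(Ẽ_ns(k̄))`); the Serre–Tate isomorphism is moreover equivariant for the
  decomposition group acting on the right through `Gal(k̄/k)`, which is not recorded here.
* `[W.IsElliptic]` is quantified in the body and continuity `h` of the Galois action on `V_ℓ E` is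
  an explicit hypothesis, as in `HasseWeilAbelian` (it is the theorem
  `WeierstrassCurve.continuous_rationalGaloisRepTate_holds`).  The hypothesis `v ∤ ℓ` is
  Silverman's "`ℓ` different from `p`".

## References

* J. H. Silverman, *Advanced Topics in the Arithmetic of Elliptic Curves*, GTM 151 (1994), §IV.10,
  proof of Thm. 10.2(a) (PDF p. 359: "the fundamental isomorphism"), with IV.9.2(c),(d)
  (PDF p. 340). [SilvermanATAEC1994]
* J.-P. Serre, J. Tate, *Good reduction of abelian varieties*, Ann. of Math. 88 (1968), §1,
  Lemmas 1–2. [SerreTate1968]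
* J. H. Silverman, *The Arithmetic of Elliptic Curves*, 2nd ed. (2009), III.2.5, VII.2.1, VII.3.1,
  VII.5.1. [SilvermanAEC2009]

## Design

`noncomputable section`, `open scoped Classical` (Mathlib's group law on `Affine.Point` wants a
`DecidableEq` on the field), one universe `u` (`K : Type u`, as in `HasseWeilAbelian`); deliberate
dot-notation extensions of Mathlib's `WeierstrassCurve` namespace, as in the sibling files.
`reductionAlgClosure` is an `abbrev` (so that `map_Δ`, `map_c₄` fire through it).
-/

noncomputable section

open scoped Classical NumberField
open Field IsDedekindDomain

universe u

namespace WeierstrassCurve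

open Literature.NumberTheory.EllipticCurves Literature.NumberTheory.GaloisRepresentations

section Reduction

variable {A : Type u} [CommRing A] [IsDedekindDomain A] {K : Type u} [Field K] [Algebra A K]
  [IsFractionRing A K] (v : HeightOneSpectrum A) (W : WeierstrassCurve K)

/-- `Ẽ_v ⊗ k̄_v`: the reduction modulo `𝔪_v` of the local minimal model of `W` at the finite place
`v` (Mathlib `WeierstrassCurve.reduction` of `W.localMinimalModel v` over
`O_v = v.adicCompletionIntegers K`; this is `W.localMinimalIntegralModel v` mapped to the residue
field `k_v` of `O_v`), base-changed to the algebraic closure `k̄_v = AlgebraicClosure k_v`.  Its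
Mathlib point group `(W.reductionAlgClosure v).toAffine.Point` is the group `Ẽ_ns(k̄_v)` of
non-singular points of the reduction (together with `O`) of Silverman, *AEC* VII.§2, §5 and
*ATAEC* IV.9.2, §IV.10 (proof of Thm. 10.2(a)).
[cite: SilvermanATAEC1994, §IV.9 Cor. 9.2 (notation Ẽ, Ẽ_ns) and proof of Thm. IV.10.2(a) (PDF pp. 340, 359)] -/
abbrev reductionAlgClosure :
    WeierstrassCurve
      (AlgebraicClosure (IsLocalRing.ResidueField (v.adicCompletionIntegers K))) :=
  ((W.localMinimalModel v).reduction (v.adicCompletionIntegers K)).baseChange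
    (AlgebraicClosure (IsLocalRing.ResidueField (v.adicCompletionIntegers K)))

/-- Unfolding: `W.reductionAlgClosure v` is the local minimal integral model
`W.localMinimalIntegralModel v` mapped along `O_v → k_v → k̄_v`. [folklore] -/
theorem reductionAlgClosure_eq_map :
    W.reductionAlgClosure v =
      (W.localMinimalIntegralModel v).map
        ((algebraMap (IsLocalRing.ResidueField (v.adicCompletionIntegers K))
            (AlgebraicClosure (IsLocalRing.ResidueField (v.adicCompletionIntegers K)))).comp
          (IsLocalRing.residue (v.adicCompletionIntegers K))) := by
  rw [reductionAlgClosure, reduction, baseChange, map_map]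
  rfl

/-- The discriminant of `Ẽ_v ⊗ k̄_v` is the residue class of `Δ(W.localMinimalIntegralModel v)`
(mapped into `k̄_v`). [folklore] -/
theorem reductionAlgClosure_Δ :
    (W.reductionAlgClosure v).Δ =
      algebraMap (IsLocalRing.ResidueField (v.adicCompletionIntegers K))
        (AlgebraicClosure (IsLocalRing.ResidueField (v.adicCompletionIntegers K)))
        (IsLocalRing.residue (v.adicCompletionIntegers K) (W.localMinimalIntegralModel v).Δ) := by
  rw [reductionAlgClosure_eq_map, map_Δ, RingHom.comp_apply]

/-- The invariant `c₄` of `Ẽ_v ⊗ k̄_v` is the residue class of `c₄(W.localMinimalIntegralModel v)`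
(mapped into `k̄_v`). [folklore] -/
theorem reductionAlgClosure_c₄ :
    (W.reductionAlgClosure v).c₄ =
      algebraMap (IsLocalRing.ResidueField (v.adicCompletionIntegers K))
        (AlgebraicClosure (IsLocalRing.ResidueField (v.adicCompletionIntegers K)))
        (IsLocalRing.residue (v.adicCompletionIntegers K) (W.localMinimalIntegralModel v).c₄) := by
  rw [reductionAlgClosure_eq_map, map_c₄, RingHom.comp_apply]

end Reduction

section Fact

variable {K : Type u} [Field K] [NumberField K] (W : WeierstrassCurve K) (ℓ : ℕ) [Fact ℓ.Prime]

/-- **The fundamental isomorphism `V_ℓ(E)^{I} ≅ V_ℓ(Ẽ_ns(k̄))`** (Serre–Tate 1968, §1, Lemma 2;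
Silverman, *ATAEC*, proof of Thm. IV.10.2(a), PDF p. 359: *"which proves the fundamental
isomorphism `V_ℓ(E(K̄))^{I(K̄/K)} ≅ V_ℓ(Ẽ_ns(k̄))`"*).  For an elliptic curve `E/K` over a number
field (`W`, `[W.IsElliptic]`), a prime `ℓ`, a proof `h` of the continuity of the Galois action on
`V_ℓ E = RationalTateModule (geomPoints W) ℓ`, a finite place `v ∤ ℓ` of `K` and a prime `𝔓` of
`\bar ℤ_K` above `v` with inertia group `I_𝔓 ≤ Γ_K` (Mathlib `Ideal.inertia`; the image of the
local inertia group `I(K̄_v/K_v)`, see the module docstring), the subspace of inertia invariants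
`(V_ℓ E)^{I_𝔓}` (`ContinuousRep.fixedSubmodule`, whose codimension is the tame part of the Artin
conductor, item G09) is `ℚ_ℓ`-linearly isomorphic to the rational Tate module
`V_ℓ(Ẽ_ns(k̄_v)) = RationalTateModule (W.reductionAlgClosure v).toAffine.Point ℓ` of the group of
non-singular points, over the algebraic closure `k̄_v` of the residue field, of the reduction
`Ẽ_v` of the minimal model of `E` at `v`.  Printed proof: `E(K^nr)/E₀(K^nr)` finite (*ATAEC*
IV.9.2(d)), `E₁(K^nr)` without `ℓ`-torsion (AEC VII.3.1), `E₀(K^nr)/E₁(K^nr) ≅ Ẽ_ns(k̄)`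
(AEC VII.2.1), and `V_ℓ(E(K^nr)) = V_ℓ(E(K̄))^{I}`.  Consequences (sibling proof file): the
multiplicative and additive cases of Thm. IV.10.2(a), `codim (V_ℓ E)^{I_𝔓} = 1, 2`, by AEC
III.2.5 (`Ẽ_ns(k̄) ≅ k̄^*`, resp. `k̄⁺`; tree `SingularCubic`).
[cite: SilvermanATAEC1994, proof of Thm. IV.10.2(a), "the fundamental isomorphism" (PDF p. 359)]
[cite: SerreTate1968, §1 Lemma 2] -/
def nonempty_fixedSubmodule_inertia_rationalTate_equiv_reductionPoints : Prop :=
  ∀ [W.IsElliptic]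
    (h : Continuous fun x : absoluteGaloisGroup K × RationalTateModule (geomPoints W) ℓ ↦
      rationalTateRepresentation (absoluteGaloisGroup K) (geomPoints W) ℓ x.1 x.2)
    (v : HeightOneSpectrum (𝓞 K)) (_hℓ : (ℓ : 𝓞 K) ∉ v.asIdeal)
    {𝔓 : Ideal (absIntegers (𝓞 K) K)} (_h𝔓 : 𝔓 ∈ v.primesAbove),
    Nonempty
      ((rationalTateGaloisRepOf (geomPoints W) ℓ h).fixedSubmodule
          (𝔓.inertia (absoluteGaloisGroup K)) ≃ₗ[ℚ_[ℓ]]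
        RationalTateModule (W.reductionAlgClosure v).toAffine.Point ℓ)

/-- Dimension form of the fundamental isomorphism: `dim_{ℚ_ℓ} (V_ℓ E)^{I_𝔓} = dim_{ℚ_ℓ} V_ℓ(Ẽ_ns(k̄_v))`
(Silverman, *ATAEC*, proof of Thm. IV.10.2(a), PDF p. 359:
`ε(E/K) = 2 - dim V_ℓ(E)^{I} = 2 - dim V_ℓ(Ẽ_ns(k̄))`), from the named fact
`nonempty_fixedSubmodule_inertia_rationalTate_equiv_reductionPoints` taken as hypothesis `hST`.
[cite: SilvermanATAEC1994, proof of Thm. IV.10.2(a) (PDF p. 359)] -/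
theorem finrank_fixedSubmodule_inertia_rationalTate_eq_of_serreTate
    (hST : W.nonempty_fixedSubmodule_inertia_rationalTate_equiv_reductionPoints ℓ) [W.IsElliptic]
    (h : Continuous fun x : absoluteGaloisGroup K × RationalTateModule (geomPoints W) ℓ ↦
      rationalTateRepresentation (absoluteGaloisGroup K) (geomPoints W) ℓ x.1 x.2)
    (v : HeightOneSpectrum (𝓞 K)) (hℓ : (ℓ : 𝓞 K) ∉ v.asIdeal)
    {𝔓 : Ideal (absIntegers (𝓞 K) K)} (h𝔓 : 𝔓 ∈ v.primesAbove) :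
    Module.finrank ℚ_[ℓ]
        ((rationalTateGaloisRepOf (geomPoints W) ℓ h).fixedSubmodule
          (𝔓.inertia (absoluteGaloisGroup K))) =
      Module.finrank ℚ_[ℓ] (RationalTateModule (W.reductionAlgClosure v).toAffine.Point ℓ) := by
  obtain ⟨e⟩ := hST h v hℓ h𝔓
  exact e.finrank_eq

end Fact

end WeierstrassCurve

end
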